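import Summits.HodgeConjecture.HodgeConjecture.Theorems.MarkmanPartnerTransportPicardThreeK3SquaresRealMultiplicationRanksCorollaries
import Summits.HodgeConjecture.HodgeConjecture.Theorems.MarkmanPartnerTransportPicardThreeK3SquaresSectorIff
import Summits.HodgeConjecture.HodgeConjecture.Theorems.MarkmanPartnerTransportPicardThreeK3SquaresKugaSatakeSectorU2ab

/-!
# Route MarkmanPartnerTransport · crux `PicardThreeK3Squares` (stmt-HodgeConjecture-19652) —
# the residue after the Kuga–Satake sector: the crux reduced to the RM clause OFF `T(S)_ℚ ≅ U_ℚ² ⊕ ⟨a⟩ ⊕ ⟨b⟩`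

`Theorems/…RealMultiplicationRanksCorollaries` pins the crux (mod Buskin's Thm. 1.1 and markings) to
the cycle-induced sector clause on the non-CM, non-scalar projective K3 surfaces with `ρ(S) ≥ 3` and
`22 − ρ(S) = e·m` (`e ≥ 2`, `m ≥ 3`), i.e. `ρ(S) ∈ {4,6,7,8,10,12,13,14,16}`.
`Theorems/…KugaSatakeSectorU2ab` proves HC for `S ⊗ S` (mod Floccari 2026 Thm. 5.11 (ii) and markings)
whenever `T(S)_ℚ ≅ U_ℚ² ⊕ ⟨a⟩ ⊕ ⟨b⟩`, `a, b < 0` (`HasTranscendentalLatticeU2ab S a b`; then `ρ(S) = 16`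
and `T(S)_ℚ` has Witt index two). This file subtracts the second from the first:

* `picardThreeK3Squares_of_residue` — **`PicardThreeK3Squares` follows, modulo
  `Buskin2019_hodgeIsometry_algebraic`, `Huybrechts_K3_marking_exists` and
  `Floccari2026_hodgeClasses_algebraic_powers_of_K3_of_transcendental_embedding`, from the cycle-induced
  sector clause on the non-CM, non-scalar projective K3 surfaces `S` with `ρ(S) ≥ 3`,
  `22 − ρ(S) = e·m` (`e ≥ 2`, `m ≥ 3`) AND `T(S)_ℚ ≇ U_ℚ² ⊕ ⟨a⟩ ⊕ ⟨b⟩` for all `a, b < 0`** — the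
  RESIDUE: at `ρ(S) = 16` only the K3 surfaces whose six-dimensional `T(S)_ℚ` (signature `(2,4)`) has
  Witt index `1` remain, the other ranks `{4,6,7,8,10,12,13,14}` are untouched. (On the subtracted
  sector the clause holds because HC for `S ⊗ S` implies it: Varesco's equivalence
  `SectorIff.cycleInducedSector_of_hodgeConjectureFor_square`.)

No definition, no sorry; named facts only as hypotheses. Prover seat hodge-nonav-19652-p1 (gen 2),
`--supports stmt-HodgeConjecture-19652`.

References: van Geemen–Schütt, Forum Math. Sigma 13 (2025) e2, §2.1; Varesco (2023) §2 and Michigan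
Math. J. 75 (2025) Thm. 4.3; Floccari, Geom. Topol. 30 (2026) Thm. 5.11; Buskin, J. reine angew.
Math. 755 (2019) Thm. 1.1.
-/

set_option linter.dupNamespace false

noncomputable section

namespace Summit.HodgeConjecture.HodgeConjecture.Theorems.MarkmanPartnerTransport.Residue

open scoped Manifold
open CategoryTheory MonoidalCategory CartesianMonoidalCategory
open Literature.AlgebraicGeometry Literature.AlgebraicGeometry.Motives Literature.AlgebraicGeometry.HodgeTheory
open Literature.AlgebraicGeometry.Surfaces
open Literature.AlgebraicTopology.SingularHomology
open Summit.HodgeConjecture.HodgeConjecture.Theorems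
open Summit.HodgeConjecture.HodgeConjecture.Theorems.MarkmanPartnerTransport

/-- `Corr[μ, hS ; γ, y] = pr₁_*(pr₂^* y ∪ γ)` on `H²(S(ℂ); ℂ)`. Local notation only. -/
local notation3 (prettyPrint := false) "Corr[" μ ", " hS " ; " γ ", " y "]" =>
  complexGysin μ (IsSmoothProjective.tensor_holds hS hS) hS
    (SemiCartesianMonoidalCategory.fst _ _) (rfl : 2 * 1 + 2 * 2 + 2 * 2 = 2 * 1 + 2 * (2 + 2))
    (cupProduct (rfl : 2 * 1 + 2 * 2 = 2 * 1 + 2 * 2)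
      (complexBetti.map (SemiCartesianMonoidalCategory.snd _ _) (2 * 1) y) γ)

/-- **The crux from the cycle-induced sector clause on the RESIDUE** (real-multiplication ranks, off
the Kuga–Satake sector `T(S)_ℚ ≅ U_ℚ² ⊕ ⟨a⟩ ⊕ ⟨b⟩`), granted Buskin's Thm. 1.1, markings and
Floccari's Thm. 5.11 (ii). The subtracted sector satisfies the clause by
`KugaSatakeSector.hodgeConjectureFor_square_of_hasTranscendentalLatticeU2ab` and Varesco's
equivalence `SectorIff.cycleInducedSector_of_hodgeConjectureFor_square`; everything else is
`RealMultiplicationRanks.picardThreeK3Squares_of_realMultiplicationRanks`.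
[cite: GeemenSchutt2023, §2.1] [cite: Varesco2025, Thm. 4.3 (§4)] [cite: Floccari2026, Thm. 5.11 (§5)]
[cite: Buskin2019, Thm. 1.1] -/
theorem picardThreeK3Squares_of_residue (hB : Buskin2019_hodgeIsometry_algebraic)
    (hmark : Huybrechts_K3_marking_exists)
    (hF : Floccari2026_hodgeClasses_algebraic_powers_of_K3_of_transcendental_embedding)
    (hRM : ∀ (S : SchemeOver ℂ) (hS : IsK3Surface S), ¬ HasComplexMultiplication S →
      3 ≤ Module.finrank ℂ ↥(algebraicClasses S 1) →
      (∃ e m : ℕ, 2 ≤ e ∧ 3 ≤ m ∧ e * m + Module.finrank ℂ ↥(algebraicClasses S 1) = 22) →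
      (∀ a b : ℤ, a < 0 → b < 0 → ¬ HasTranscendentalLatticeU2ab S a b) →
      (¬ ∀ (f : complexBetti S (2 * 1) →ₗ[ℂ] complexBetti S (2 * 1)),
        (∀ y, IsRationalClass y → IsRationalClass (f y)) →
        (∀ (i j : ℕ) y, IsOfHodgeType 2 S (2 * 1) i j y → IsOfHodgeType 2 S (2 * 1) i j (f y)) →
        (∀ d ∈ algebraicClasses S 1, f d = 0) →
        (∀ y : complexBetti S (2 * 1), ∀ d ∈ algebraicClasses S 1,
          cupProduct (rfl : 2 * 1 + 2 * 1 = 2 * 2) (f y) d = 0) →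
        ∃ a : ℚ, ∀ y : complexBetti S (2 * 1),
          (∀ d ∈ algebraicClasses S 1, cupProduct (rfl : 2 * 1 + 2 * 1 = 2 * 2) y d = 0) →
            f y = (a : ℂ) • y) →
      ∀ (f : complexBetti S (2 * 1) →ₗ[ℂ] complexBetti S (2 * 1)),
        (∀ y, IsRationalClass y → IsRationalClass (f y)) →
        (∀ (i j : ℕ) y, IsOfHodgeType 2 S (2 * 1) i j y → IsOfHodgeType 2 S (2 * 1) i j (f y)) →
        (∀ d ∈ algebraicClasses S 1, f d = 0) →
        (∀ y : complexBetti S (2 * 1), ∀ d ∈ algebraicClasses S 1,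
          cupProduct (rfl : 2 * 1 + 2 * 1 = 2 * 2) (f y) d = 0) →
        ∃ g : complexBetti S (2 * 1) →ₗ[ℂ] complexBetti S (2 * 1),
          (∀ d ∈ algebraicClasses S 1, g d ∈ algebraicClasses S 1) ∧
          (∃ γ ∈ algebraicClasses (S ⊗ S) 2, ∀ y : complexBetti S (2 * 1),
            g y = Corr[complexOrientationFamily, hS.isSmoothProjective ; γ, y]) ∧
          ∀ y : complexBetti S (2 * 1),
            (∀ d ∈ algebraicClasses S 1, cupProduct (rfl : 2 * 1 + 2 * 1 = 2 * 2) y d = 0) →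
              f y = g y) :
    Summit.HodgeConjecture.HodgeConjecture.Theses.MarkmanPartnerTransport.PicardThreeK3Squares :=
  RealMultiplicationRanks.picardThreeK3Squares_of_realMultiplicationRanks hB hmark
    fun S hS hCM h3 hem hQ => by
      by_cases hU : ∃ a b : ℤ, a < 0 ∧ b < 0 ∧ HasTranscendentalLatticeU2ab S a b
      · obtain ⟨a, b, ha, hb, hT⟩ := hU
        exact SectorIff.cycleInducedSector_of_hodgeConjectureFor_square complexOrientationFamily
          hS.isSmoothProjective
          (KugaSatakeSector.hodgeConjectureFor_square_of_hasTranscendentalLatticeU2ab hF hmark hS ha hb hT)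
      · push Not at hU
        exact hRM S hS hCM h3 hem (fun a b ha hb => hU a b ha hb) hQ

/-- **The crux is EQUIVALENT to the clause on the residue** (mod Buskin's Thm. 1.1, markings and
Floccari's Thm. 5.11 (ii)): `⇐` is `picardThreeK3Squares_of_residue`; `⇒` holds because the crux gives
HC for `S ⊗ S` at every `ρ(S) ≥ 3`, which implies the clause (Varesco's equivalence,
`SectorIff.cycleInducedSector_of_picardThreeK3Squares`). This is the exact open content of item
stmt-HodgeConjecture-19652 after gen 0–2 of the prover lane, as one kernel statement.
[cite: Varesco2023, §2 (p. 8)] [cite: GeemenSchutt2023, §2.1] [cite: Floccari2026, Thm. 5.11 (§5)] -/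
theorem picardThreeK3Squares_iff_residue (hB : Buskin2019_hodgeIsometry_algebraic)
    (hmark : Huybrechts_K3_marking_exists)
    (hF : Floccari2026_hodgeClasses_algebraic_powers_of_K3_of_transcendental_embedding) :
    Summit.HodgeConjecture.HodgeConjecture.Theses.MarkmanPartnerTransport.PicardThreeK3Squares ↔
    ∀ (S : SchemeOver ℂ) (hS : IsK3Surface S), ¬ HasComplexMultiplication S →
      3 ≤ Module.finrank ℂ ↥(algebraicClasses S 1) →
      (∃ e m : ℕ, 2 ≤ e ∧ 3 ≤ m ∧ e * m + Module.finrank ℂ ↥(algebraicClasses S 1) = 22) →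
      (∀ a b : ℤ, a < 0 → b < 0 → ¬ HasTranscendentalLatticeU2ab S a b) →
      (¬ ∀ (f : complexBetti S (2 * 1) →ₗ[ℂ] complexBetti S (2 * 1)),
        (∀ y, IsRationalClass y → IsRationalClass (f y)) →
        (∀ (i j : ℕ) y, IsOfHodgeType 2 S (2 * 1) i j y → IsOfHodgeType 2 S (2 * 1) i j (f y)) →
        (∀ d ∈ algebraicClasses S 1, f d = 0) →
        (∀ y : complexBetti S (2 * 1), ∀ d ∈ algebraicClasses S 1,
          cupProduct (rfl : 2 * 1 + 2 * 1 = 2 * 2) (f y) d = 0) →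
        ∃ a : ℚ, ∀ y : complexBetti S (2 * 1),
          (∀ d ∈ algebraicClasses S 1, cupProduct (rfl : 2 * 1 + 2 * 1 = 2 * 2) y d = 0) →
            f y = (a : ℂ) • y) →
      ∀ (f : complexBetti S (2 * 1) →ₗ[ℂ] complexBetti S (2 * 1)),
        (∀ y, IsRationalClass y → IsRationalClass (f y)) →
        (∀ (i j : ℕ) y, IsOfHodgeType 2 S (2 * 1) i j y → IsOfHodgeType 2 S (2 * 1) i j (f y)) →
        (∀ d ∈ algebraicClasses S 1, f d = 0) →
        (∀ y : complexBetti S (2 * 1), ∀ d ∈ algebraicClasses S 1,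
          cupProduct (rfl : 2 * 1 + 2 * 1 = 2 * 2) (f y) d = 0) →
        ∃ g : complexBetti S (2 * 1) →ₗ[ℂ] complexBetti S (2 * 1),
          (∀ d ∈ algebraicClasses S 1, g d ∈ algebraicClasses S 1) ∧
          (∃ γ ∈ algebraicClasses (S ⊗ S) 2, ∀ y : complexBetti S (2 * 1),
            g y = Corr[complexOrientationFamily, hS.isSmoothProjective ; γ, y]) ∧
          ∀ y : complexBetti S (2 * 1),
            (∀ d ∈ algebraicClasses S 1, cupProduct (rfl : 2 * 1 + 2 * 1 = 2 * 2) y d = 0) →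
              f y = g y :=
  ⟨fun h S hS _ h3 _ _ _ =>
    SectorIff.cycleInducedSector_of_picardThreeK3Squares h hmark complexOrientationFamily S hS h3,
   fun h => picardThreeK3Squares_of_residue hB hmark hF h⟩

/-! ### The anchor constraint of line `cm-anchor-spread` (lead verdict g2, evidence #32): self-adjoint similitudes are quadratic -/

/-- **A self-adjoint similitude squares to a scalar.** For a non-degenerate bilinear form `B` on `V`
and an endomorphism `t` with `B (t x) (t y) = d · B x y` (similitude of multiplier `d`) and
`B (t x) y = B x (t y)` (self-adjoint), `t (t x) = d • x`. This is the algebra behind the lead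
verdict on line `cm-anchor-spread` (item evidence #32, §E2): the correspondence action on `T(S₀)` of
the graph closure of a dominant rational self-map of degree `d` of a K3 surface is a similitude of
multiplier `d`, while every element of a totally real `End_Hdg T(S)` is self-adjoint (Zarhin), so a
real-multiplication generator realised by such a graph satisfies `t² = d`, i.e. generates a field of
degree `≤ 2` — no graph-type anchor exists for cubic or quintic real multiplication
(`ρ(S) ∈ {7, 13}`). [cite: Zarhin1983HodgeGroupsK3, Thm. 1.5.1] [cite: GeemenSchutt2023, Thm. 1.2 (§6)] -/
theorem apply_apply_eq_smul_of_selfAdjoint_similitude {K V : Type*} [Field K] [AddCommGroup V]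
    [Module K V] (B : LinearMap.BilinForm K V) (hB : B.Nondegenerate) (t : V →ₗ[K] V) (d : K)
    (hsim : ∀ x y, B (t x) (t y) = d * B x y) (hsa : ∀ x y, B (t x) y = B x (t y)) (x : V) :
    t (t x) = d • x := by
  have h : ∀ y, B (t (t x) - d • x) y = 0 := fun y => by
    rw [map_sub, LinearMap.sub_apply, hsa, hsim, map_smul, LinearMap.smul_apply, smul_eq_mul, sub_self]
  exact sub_eq_zero.1 (hB.1 _ h)

end Summit.HodgeConjecture.HodgeConjecture.Theorems.MarkmanPartnerTransport.Residue

end
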